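import Literature.NumberTheory.CubicFields.ShintaniLandauKernel
import HarnessLib

/-!
# The Riesz mean of order three: Landau's differencing sandwich and the main terms

Topic `Literature/NumberTheory/CubicFields` (the elementary half of Landau's finite-differencing method, [LDTT] §2.2
Lemma 7 and (eq:monotone_inequality), for `k = 3`). With `A³(u) = Σ_{n ≤ u} a_n (u − n)³` (`= 3!` times the Riesz
mean) and the third forward difference `Δ_y³` (Mathlib's `fwdDiff`, iterated):

* `LandauDiff.fwdDiff_three_posPartCube_*` — `0 ≤ Δ_y³ (u ↦ ((u − n)⁺)³)(X) ≤ 6y³`, with equality `6y³` for `n ≤ X`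
  and `0` for `n ≥ X + 3y` (a case analysis of the cubic B-spline);
* `LandauDiff.riesz_three_sandwich` — for `a_n ≥ 0`:
  `6y³ Σ_{n ≤ X} a_n ≤ Δ_y³ A³(X) ≤ 6y³ Σ_{n ≤ X+3y} a_n` ([LDTT] (eq:monotone_inequality): "`y^k A⁰(X) ≤ Δ_y^k A^k(X)
  ≤ y^k A⁰(X + ky)`", `k = 3`, `A^k = A³/3!`);
* `LandauDiff.norm_fwdDiff_three_cpow_sub_le` — the main-term extraction
  `‖Δ_y³ (t ↦ t^w)(X) − w(w−1)(w−2) X^{w−3} y³‖ ≤ 3y⁴ ‖w(w−1)(w−2)(w−3)‖ max(X^{Re w−4}, (X+3y)^{Re w−4})`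
  ([LDTT] Lemma 7, (eq:S_diff): `Δ_y^k S^k_φ(X) = S⁰_φ(X) y^k + O(y^{k+1} X^{−1} R_φ(X))`, termwise for a pole at `w − 3`),
  by the derivative-closed family calculus of `ShintaniLandauKernel.lean` applied to `t^w − g₃(X)(t − X)³/6`.

Everything here is PROVED (no definitions besides the auxiliary families `posPartCube`, `polyFamily`, `cpowSubFamily`;
no named facts).

## References

* D. Lowry-Duda, T. Taniguchi, F. Thorne, *Uniform bounds for lattice point counting and partial sums of zeta
  functions*, Math. Z. 300 (2022) = arXiv:1710.02190, §2.2 Lemma 7, (eq:S_diff), (eq:monotone_inequality),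
  §2.3 (proof of Lemma 7). [LowrydudaTaniguchiThorne2017]
* K. Chandrasekharan, R. Narasimhan, *Functional equations with multiple gamma factors and the average order of
  arithmetical functions*, Ann. of Math. 76 (1962), §4 (the finite-differencing method).
-/

noncomputable section

open Complex Real Set

namespace Literature.NumberTheory.CubicFields

namespace LandauDiff

/-! ### The cubic B-spline bounds `0 ≤ Δ_y³((u − n)⁺)³ ≤ 6y³` -/

/-- `((u − n)⁺)³` as a real function of `u`. [folklore] -/
def posPartCube (n : ℝ) (u : ℝ) : ℝ := (max (u - n) 0) ^ 3

/-- `((u − n)⁺)³ = (u − n)³` for `n ≤ u`. [folklore] -/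
theorem posPartCube_of_le {n u : ℝ} (h : n ≤ u) : posPartCube n u = (u - n) ^ 3 := by
  rw [posPartCube, max_eq_left (by linarith)]

/-- `((u − n)⁺)³ = 0` for `u ≤ n`. [folklore] -/
theorem posPartCube_of_ge {n u : ℝ} (h : u ≤ n) : posPartCube n u = 0 := by
  rw [posPartCube, max_eq_right (by linarith)]; ring

/-- `Δ_y³` of a real function, written out. [folklore] -/
theorem fwdDiff_iter_three_apply_real (f : ℝ → ℝ) (y X : ℝ) :
    ((fwdDiff y)^[3] f) X = f (X + 3 * y) - 3 * f (X + 2 * y) + 3 * f (X + y) - f X := by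
  simp only [Function.iterate_succ_apply', Function.iterate_zero_apply, fwdDiff]
  ring_nf

/-- **`Δ_y³((u − n)⁺)³(X) = 6y³` for `n ≤ X`.** [cite: LowrydudaTaniguchiThorne2017, §2.3 (proof of Lemma 7: "the explicit evaluation Δ_y^k (X − λ_n)^k = y^k Γ(k+1)")] -/
theorem fwdDiff_three_posPartCube_of_le {n X y : ℝ} (hy : 0 ≤ y) (h : n ≤ X) :
    ((fwdDiff y)^[3] (posPartCube n)) X = 6 * y ^ 3 := by
  rw [fwdDiff_iter_three_apply_real, posPartCube_of_le h, posPartCube_of_le (by linarith),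
    posPartCube_of_le (by linarith), posPartCube_of_le (by linarith)]
  ring

/-- **`Δ_y³((u − n)⁺)³(X) = 0` for `n ≥ X + 3y`.** [folklore] -/
theorem fwdDiff_three_posPartCube_of_ge {n X y : ℝ} (hy : 0 ≤ y) (h : X + 3 * y ≤ n) :
    ((fwdDiff y)^[3] (posPartCube n)) X = 0 := by
  rw [fwdDiff_iter_three_apply_real, posPartCube_of_ge h, posPartCube_of_ge (by linarith),
    posPartCube_of_ge (by linarith), posPartCube_of_ge (by linarith)]
  ring

/-- **`0 ≤ Δ_y³((u − n)⁺)³(X) ≤ 6y³`** for all `n` (`y ≥ 0`): the case analysis of the cubic B-spline on the four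
cells `n ≤ X`, `X < n ≤ X+y`, `X+y < n ≤ X+2y`, `X+2y < n < X+3y`, `n ≥ X+3y`.
[cite: LowrydudaTaniguchiThorne2017, §2.2 (eq:monotone_inequality) (monotonicity of the differenced Riesz means for nonnegative coefficients)] -/
theorem fwdDiff_three_posPartCube_mem {n X y : ℝ} (hy : 0 ≤ y) :
    0 ≤ ((fwdDiff y)^[3] (posPartCube n)) X ∧ ((fwdDiff y)^[3] (posPartCube n)) X ≤ 6 * y ^ 3 := by
  have hy3 : 0 ≤ y ^ 3 := by positivity
  rcases le_or_gt n X with h0 | h0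
  · rw [fwdDiff_three_posPartCube_of_le hy h0]; exact ⟨by positivity, le_rfl⟩
  rcases le_or_gt (X + 3 * y) n with h3 | h3
  · rw [fwdDiff_three_posPartCube_of_ge hy h3]; exact ⟨le_rfl, by positivity⟩
  rw [fwdDiff_iter_three_apply_real, posPartCube_of_ge h0.le]
  rcases le_or_gt n (X + y) with h1 | h1
  · -- `X < n ≤ X + y`: with `v = X + y − n ∈ [0, y)`, value `(v − y)³ + 6y³ ∈ [5y³, 6y³]`
    rw [posPartCube_of_le (by linarith), posPartCube_of_le (by linarith), posPartCube_of_le h1]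
    set v := X + y - n with hv
    have hv0 : 0 ≤ v := by linarith
    have hvy : v < y := by linarith
    have e : (X + 3 * y - n) ^ 3 - 3 * (X + 2 * y - n) ^ 3 + 3 * (X + y - n) ^ 3 - 0 = (v - y) ^ 3 + 6 * y ^ 3 := by
      rw [hv]; ring
    rw [e]
    constructor <;> nlinarith [mul_nonneg hv0 hy, sq_nonneg (v - y), sq_nonneg v, mul_nonneg (mul_nonneg hv0 hv0) hv0]
  rcases le_or_gt n (X + 2 * y) with h2 | h2
  · -- `X + y < n ≤ X + 2y`: with `v = X + 2y − n ∈ [0, y)`, value `(v + y)³ − 3v³ = −2v³ + 3v²y + 3vy² + y³`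
    rw [posPartCube_of_le (by linarith), posPartCube_of_le h2, posPartCube_of_ge h1.le]
    set v := X + 2 * y - n with hv
    have hv0 : 0 ≤ v := by linarith
    have hvy : v < y := by linarith
    have e : (X + 3 * y - n) ^ 3 - 3 * (X + 2 * y - n) ^ 3 + 3 * 0 - 0 = (v + y) ^ 3 - 3 * v ^ 3 := by rw [hv]; ring
    rw [e]
    constructor <;> nlinarith [mul_nonneg hv0 hy, sq_nonneg (v - y), sq_nonneg v, mul_nonneg (mul_nonneg hv0 hv0) hv0,
      mul_nonneg (mul_nonneg hv0 hv0) hy, mul_nonneg (mul_nonneg hv0 hy) hy]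
  · -- `X + 2y < n < X + 3y`: value `(X + 3y − n)³ ∈ (0, y³)`
    rw [posPartCube_of_le h3.le, posPartCube_of_ge h2.le, posPartCube_of_ge (by linarith)]
    set v := X + 3 * y - n with hv
    have hv0 : 0 ≤ v := by linarith
    have hvy : v ≤ y := by linarith
    have e : v ^ 3 - 3 * 0 + 3 * 0 - 0 = v ^ 3 := by ring
    rw [e]
    exact ⟨by positivity, by nlinarith [pow_le_pow_left₀ hv0 hvy 3]⟩

/-! ### The sandwich for nonnegative coefficients -/

/-- The order-three Riesz sum `A³(u) = Σ_{0 < n ≤ u} a_n (u − n)³` of a real sequence. [cite: LowrydudaTaniguchiThorne2017, §2.2 (the smoothed sums A^k_φ(X), k = 3, times Γ(4) = 6)] -/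
def rieszThree (a : ℕ → ℝ) (u : ℝ) : ℝ := ∑ n ∈ Finset.Ioc 0 ⌊u⌋₊, a n * (u - n) ^ 3

/-- `A³(u) = Σ_{0 < n ≤ M} a_n ((u − n)⁺)³` for any `M ≥ ⌊u⌋₊` (`u ≥ 0`): extra terms vanish. [folklore] -/
theorem rieszThree_eq_sum_posPartCube (a : ℕ → ℝ) {u : ℝ} (hu : 0 ≤ u) {M : ℕ} (hM : ⌊u⌋₊ ≤ M) :
    rieszThree a u = ∑ n ∈ Finset.Ioc 0 M, a n * posPartCube n u := by
  rw [rieszThree]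
  have hsub : Finset.Ioc 0 ⌊u⌋₊ ⊆ Finset.Ioc 0 M := Finset.Ioc_subset_Ioc_right hM
  rw [← Finset.sum_subset hsub]
  · refine Finset.sum_congr rfl fun n hn => ?_
    rw [posPartCube_of_le (Nat.floor_le hu |>.trans' (by exact_mod_cast (Finset.mem_Ioc.mp hn).2))]
  · intro n hn hn'
    have hlt : ⌊u⌋₊ < n := by
      rw [Finset.mem_Ioc] at hn hn'; push Not at hn'; omega
    rw [posPartCube_of_ge (Nat.lt_of_floor_lt hlt).le, mul_zero]

/-- **Landau's sandwich `6y³ Σ_{n ≤ X} a_n ≤ Δ_y³ A³(X) ≤ 6y³ Σ_{n ≤ X+3y} a_n`** for `a_n ≥ 0`, `X, y ≥ 0`.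
[cite: LowrydudaTaniguchiThorne2017, §2.2 (eq:monotone_inequality) (y^k A⁰_φ(X) ≤ Δ_y^k A^k_φ(X) ≤ y^k A⁰_φ(X + ky), k = 3)] -/
theorem riesz_three_sandwich {a : ℕ → ℝ} (ha : ∀ n, 0 ≤ a n) {X y : ℝ} (hX : 0 ≤ X) (hy : 0 ≤ y) :
    6 * y ^ 3 * ∑ n ∈ Finset.Ioc 0 ⌊X⌋₊, a n ≤ ((fwdDiff y)^[3] (rieszThree a)) X ∧
      ((fwdDiff y)^[3] (rieszThree a)) X ≤ 6 * y ^ 3 * ∑ n ∈ Finset.Ioc 0 ⌊X + 3 * y⌋₊, a n := by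
  set M : ℕ := ⌊X + 3 * y⌋₊ with hM
  have hmono : ∀ u : ℝ, 0 ≤ u → u ≤ X + 3 * y → ⌊u⌋₊ ≤ M := fun u _ h => Nat.floor_le_floor h
  -- on the four points `A³ = Σ_{n ≤ M} a_n ((u − n)⁺)³`
  have key : ((fwdDiff y)^[3] (rieszThree a)) X = ∑ n ∈ Finset.Ioc 0 M, a n * ((fwdDiff y)^[3] (posPartCube n)) X := by
    rw [fwdDiff_iter_three_apply_real,
      rieszThree_eq_sum_posPartCube a (by positivity) (hmono _ (by positivity) le_rfl),
      rieszThree_eq_sum_posPartCube a (by positivity) (hmono _ (by positivity) (by linarith)),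
      rieszThree_eq_sum_posPartCube a (by positivity) (hmono _ (by positivity) (by linarith)),
      rieszThree_eq_sum_posPartCube a hX (hmono _ hX (by linarith))]
    simp only [fwdDiff_iter_three_apply_real, mul_sub, mul_add, Finset.sum_sub_distrib, Finset.sum_add_distrib,
      Finset.mul_sum]
    ring_nf
  rw [key]
  constructor
  · -- lower: the terms `n ≤ ⌊X⌋` are exactly `6y³ a_n`, the rest are `≥ 0`
    have hsub : Finset.Ioc 0 ⌊X⌋₊ ⊆ Finset.Ioc 0 M := Finset.Ioc_subset_Ioc_right (hmono X hX (by linarith))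
    have heq : 6 * y ^ 3 * ∑ n ∈ Finset.Ioc 0 ⌊X⌋₊, a n =
        ∑ n ∈ Finset.Ioc 0 ⌊X⌋₊, a n * ((fwdDiff y)^[3] (posPartCube n)) X := by
      rw [Finset.mul_sum]
      refine Finset.sum_congr rfl fun n hn => ?_
      have hnX : (n : ℝ) ≤ X := (Nat.floor_le hX).trans' (by exact_mod_cast (Finset.mem_Ioc.mp hn).2)
      rw [fwdDiff_three_posPartCube_of_le hy hnX]; ring
    rw [heq]
    exact Finset.sum_le_sum_of_subset_of_nonneg hsub fun n _ _ =>
      mul_nonneg (ha n) (fwdDiff_three_posPartCube_mem (n := (n : ℝ)) (X := X) hy).1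
  · rw [Finset.mul_sum]
    refine Finset.sum_le_sum fun n _ => ?_
    have := (fwdDiff_three_posPartCube_mem (n := (n : ℝ)) (X := X) hy).2
    nlinarith [ha n]

/-! ### Main-term extraction: `Δ_y³ t^w = w(w−1)(w−2) X^{w−3} y³ + O(y⁴ X^{Re w−4})` -/

/-- The cubic `(t − X)³/6` and its successive derivatives `(t − X)²/2`, `t − X`, `1`, `0`, … [folklore] -/
def polyFamily (X : ℝ) : ℕ → ℝ → ℂ
  | 0 => fun t => (((t - X : ℝ) : ℂ)) ^ 3 / 6
  | 1 => fun t => (((t - X : ℝ) : ℂ)) ^ 2 / 2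
  | 2 => fun t => ((t - X : ℝ) : ℂ)
  | 3 => fun _ => 1
  | _ + 4 => fun _ => 0

/-- `p_k' = p_{k+1}`. [folklore] -/
theorem hasDerivAt_polyFamily (X : ℝ) (k : ℕ) (t : ℝ) : HasDerivAt (polyFamily X k) (polyFamily X (k + 1) t) t := by
  have h0 : HasDerivAt (fun u : ℝ => ((u - X : ℝ) : ℂ)) 1 t := by
    simpa using ((hasDerivAt_id t).sub_const X).ofReal_comp
  match k with
  | 0 =>
    have h := (h0.pow 3).div_const 6
    refine h.congr_deriv ?_
    simp only [polyFamily]; push_cast; ring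
  | 1 =>
    have h := (h0.pow 2).div_const 2
    refine h.congr_deriv ?_
    simp only [polyFamily]; push_cast; ring
  | 2 =>
    refine h0.congr_deriv ?_
    simp [polyFamily]
  | 3 =>
    simpa [polyFamily] using hasDerivAt_const t (1 : ℂ)
  | k + 4 =>
    simpa [polyFamily] using hasDerivAt_const t (0 : ℂ)

/-- `Δ_y³ p₀(X) = y³`. [folklore] -/
theorem fwdDiff_three_polyFamily_zero (X y : ℝ) : ((fwdDiff y)^[3] (polyFamily X 0)) X = (y : ℂ) ^ 3 := by
  rw [fwdDiff_iter_three_apply]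
  simp only [polyFamily]
  push_cast
  ring

/-- The family `h_k(t) = g_k(t) − g₃(X) p_k(t)` (with `g_k = cpowFamily w k`), again derivative-closed. [folklore] -/
def cpowSubFamily (w : ℂ) (X : ℝ) (k : ℕ) (t : ℝ) : ℂ := cpowFamily w k t - cpowFamily w 3 X * polyFamily X k t

/-- `h_k' = h_{k+1}` on `t > 0`. [folklore] -/
theorem hasDerivAt_cpowSubFamily (w : ℂ) (X : ℝ) (k : ℕ) {t : ℝ} (ht : 0 < t) :
    HasDerivAt (cpowSubFamily w X k) (cpowSubFamily w X (k + 1) t) t :=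
  (hasDerivAt_cpowFamily w k ht).sub ((hasDerivAt_polyFamily X k t).const_mul _)

/-- `‖g₃(s) − g₃(X)‖ ≤ (s − X) ‖w(w−1)(w−2)(w−3)‖ max(X^{Re w−4}, (X+L)^{Re w−4})` for `X ≤ s ≤ X + L` (one mean-value step).
[folklore] -/
theorem norm_cpowFamily_three_sub_le (w : ℂ) {X L s : ℝ} (hX : 0 < X) (hs : s ∈ Icc X (X + L)) :
    ‖cpowFamily w 3 s - cpowFamily w 3 X‖ ≤
      (s - X) * (‖w * (w - 1) * (w - 2) * (w - 3)‖ * max (X ^ (w.re - 4)) ((X + L) ^ (w.re - 4))) := by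
  have hsX : 0 ≤ s - X := by linarith [hs.1]
  -- `g₃(s) − g₃(X) = Δ_{s−X} g₃ (X)`, one step of the family calculus with `n = 1`, `k = 3`
  have h := norm_fwdDiff_iter_le (hasDerivAt_cpowFamily w) hsX 1 3 X hX
    (‖w * (w - 1) * (w - 2) * (w - 3)‖ * max (X ^ (w.re - 4)) ((X + L) ^ (w.re - 4))) (fun s' hs' => ?_)
  · simpa [fwdDiff] using h
  · have hs'0 : 0 < s' := lt_of_lt_of_le hX hs'.1
    have hs'L : s' ∈ Icc X (X + L) := ⟨hs'.1, hs'.2.trans (by push_cast; linarith [hs.2])⟩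
    rw [norm_cpowFamily hs'0]
    have hprod : ‖∏ j ∈ Finset.range (3 + 1), (w - j)‖ = ‖w * (w - 1) * (w - 2) * (w - 3)‖ := by
      simp [Finset.prod_range_succ]
    rw [hprod]
    refine mul_le_mul_of_nonneg_left ?_ (norm_nonneg _)
    have : w.re - ((3 + 1 : ℕ) : ℝ) = w.re - 4 := by norm_num
    rw [this]
    exact rpow_le_max_of_mem_Icc hX hs'L

/-- **`‖Δ_y³ (t ↦ t^w)(X) − w(w−1)(w−2) X^{w−3} y³‖ ≤ 3y⁴ ‖w(w−1)(w−2)(w−3)‖ max(X^{Re w−4}, (X+3y)^{Re w−4})`**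
(`X > 0`, `y ≥ 0`): the third difference of a power is its third derivative times `y³` up to `O(y⁴ · |4th derivative|)`.
[cite: LowrydudaTaniguchiThorne2017, Lemma 7 (eq:S_diff) with §2.3 (eq:finite_diff_iterated), (eq:S_iterated_integral)] -/
theorem norm_fwdDiff_three_cpow_sub_le (w : ℂ) {X y : ℝ} (hX : 0 < X) (hy : 0 ≤ y) :
    ‖((fwdDiff y)^[3] (fun t : ℝ => (t : ℂ) ^ w)) X - w * (w - 1) * (w - 2) * (X : ℂ) ^ (w - 3) * (y : ℂ) ^ 3‖ ≤
      3 * y ^ 4 * (‖w * (w - 1) * (w - 2) * (w - 3)‖ * max (X ^ (w.re - 4)) ((X + 3 * y) ^ (w.re - 4))) := by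
  -- `Δ³ h₀ (X) = Δ³ (t^w)(X) − g₃(X) y³`
  have hc : cpowFamily w 3 X = w * (w - 1) * (w - 2) * (X : ℂ) ^ (w - 3) := by
    rw [cpowFamily]; simp [Finset.prod_range_succ]
  have hdiff : ((fwdDiff y)^[3] (cpowSubFamily w X 0)) X =
      ((fwdDiff y)^[3] (fun t : ℝ => (t : ℂ) ^ w)) X - w * (w - 1) * (w - 2) * (X : ℂ) ^ (w - 3) * (y : ℂ) ^ 3 := by
    have e : ∀ t, cpowSubFamily w X 0 t = (t : ℂ) ^ w - cpowFamily w 3 X * polyFamily X 0 t := fun t => by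
      rw [cpowSubFamily, cpowFamily_zero]
    rw [fwdDiff_iter_three_apply, e, e, e, e, fwdDiff_iter_three_apply, hc]
    have hp := fwdDiff_three_polyFamily_zero X y
    rw [fwdDiff_iter_three_apply] at hp
    linear_combination (-(w * (w - 1) * (w - 2) * (X : ℂ) ^ (w - 3))) * hp
  rw [← hdiff]
  -- the family bound with `n = 3`, `k = 0`
  set B : ℝ := 3 * y * (‖w * (w - 1) * (w - 2) * (w - 3)‖ * max (X ^ (w.re - 4)) ((X + 3 * y) ^ (w.re - 4))) with hB
  have h := norm_fwdDiff_iter_le (hasDerivAt_cpowSubFamily w X) hy 3 0 X hX B (fun s hs => ?_)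
  · calc ‖((fwdDiff y)^[3] (cpowSubFamily w X 0)) X‖ ≤ y ^ 3 * B := h
      _ = 3 * y ^ 4 * (‖w * (w - 1) * (w - 2) * (w - 3)‖ * max (X ^ (w.re - 4)) ((X + 3 * y) ^ (w.re - 4))) := by
          rw [hB]; ring
  · -- `‖h₃(s)‖ = ‖g₃(s) − g₃(X)‖ ≤ (s − X)(…) ≤ 3y (…)`
    have hs' : s ∈ Icc X (X + 3 * y) := by simpa using hs
    have e3 : cpowSubFamily w X (0 + 3) s = cpowFamily w 3 s - cpowFamily w 3 X := by
      simp [cpowSubFamily, polyFamily]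
    rw [e3]
    refine (norm_cpowFamily_three_sub_le w hX hs').trans ?_
    rw [hB]
    refine mul_le_mul_of_nonneg_right (by linarith [hs'.2]) (by positivity)

end LandauDiff

end Literature.NumberTheory.CubicFields

end
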